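import Summits.CriticalPhenomena.PercolationContinuityZ3.Theorems.PercNearOneGluingNoHeavyLowerTailCILSetStarTools
import Summits.CriticalPhenomena.PercolationContinuityZ3.Theorems.PercNearOneGluingNoHeavyLowerTailCILInduction
import HarnessLib

/-!
# `NoHeavyLowerTail` (stmt-CriticalPhenomena-4575) — set-champion stability from a UNION BOUND over the first open port
# (the quantitative terminal rule of the port-elimination certificates)

Support file (prover `prim-lf-3`, lemma factory #3; `--supports stmt-CriticalPhenomena-4575`).  No definitions, no named facts,
no sorries.

Notation (as in `…CILSetStarTools`): `μ = prodBernoulli w` on `Fin n`, relays `A`, level `j`, an observer SET `S` disjoint from `A`, a witness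
`c ∈ A ∖ S`; `π(v) = {z ∈ A : v ↔ z}`, `π(S) = {z ∈ A : ∃ x ∈ S, x ↔ z}`; `ξ(ω) = ω ∩ {e | ∀ v ∈ S, v ∉ e}` the configuration OFF `S`,
`~'` reachability in `ξ(ω)`, `π'(u)` the relays `~'`-joined to `u`; the GATE SET `Γ(ω) = {u ∉ S | ∃ v ∈ S, s(u,v) ∈ ω}`.  Set-champion stability
`CS_w(S, c) : μ(c ↮ S, 1 ≤ |π(S)| ≤ j) ≤ μ(c ↮ S, |π(c)| ≤ j)` says that `c` is a valid CIL witness for the observer obtained by gluing `S`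
(`CutObserver.bad_le_glued_iff_setCS`).

**Theorem (`setCS_of_unionBound`).**  Let `𝒴` be a finite family carrying `Γ` almost surely and `g` a choice of a member `g Y ∈ Y` of every
nonempty `Y ∈ 𝒴`.  If
  `Σ_{Y ∈ 𝒴, Y ≠ ∅} μ{Γ = Y} · μ{|π'(g Y)| ≤ j}  ≤  μ(c ↮ S, |π(c)| ≤ j) + μ(c ↔ S, |π(S)| ≤ j)`
(the right-hand side is the lightness of `c` in the graph with `S` glued), then `CS_w(S, c)`.

Proof (`bad_inter_gateEq_le`): on `{Γ = Y}` with `Y ∋ u` a gate, every relay `~'`-joined to `u` is joined to `S`, so `1 ≤ |π(S)| ≤ j` forces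
`|π'(u)| ≤ j`; the gate class is independent of the `ξ`-events (`SetStar.measureReal_gateEq_inter_off`); on `{Γ = ∅}` the set `π(S)` is empty
(`SetStar.exists_reach_iff_gate`).  Summing over the partition by `Γ` (`SetStar.measureReal_eq_sum_gateEq`) bounds the glued observer's bad mass
`μ{1 ≤ |π(S)| ≤ j}` by the left-hand side, and `bad ≤ glued lightness of c` is `CS_w(S, c)` (`bad_le_glued_iff_setCS`).

Role (crux memo LF3-PEC.md, item evidence): with `g Y` = the member of `Y` minimising `μ{|π'(·)| ≤ j}` this is the terminal rule [UB]
("`E[min over open ports of the R-lightness] ≤ J(S, c)`") of the certificate language for the relay-neighboured pair atom TPS / RN-CS(2);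
the exact witness W_B of the memo shows that no domination-only terminal family replaces it.  The step rules are `…SetCSPortElimination`.
-/

noncomputable section

namespace Summit.CriticalPhenomena.PercolationContinuityZ3.Theorems

open MeasureTheory Set Literature.Probability.LatticeModels Literature.Probability.Percolation
open scoped Classical BigOperators

variable {n : ℕ}

namespace PortElimination

open CutObserver CutObserver.SetStar

/-- **Union bound on a gate class.**  For a finite set `Y` and `u ∈ Y`:
`μ({1 ≤ |π(S)| ≤ j} ∩ {Γ = Y}) ≤ μ{Γ = Y} · μ{|π'(u)| ≤ j}` — on `{Γ = Y}` the gate `u` carries an open edge into `S`, so the relays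
`~'`-joined to `u` are joined to `S`. [folklore] -/
theorem bad_inter_gateEq_le (w : Sym2 (Fin n) → unitInterval) (A S Y : Finset (Fin n)) (j : ℕ)
    (u : Fin n) (hu : u ∈ Y) :
    (prodBernoulli w).real
        ({ω : BondConfig (Fin n) | 1 ≤ (A.filter fun z => ∃ x ∈ S, ω ∈ openConn x z).card ∧
            (A.filter fun z => ∃ x ∈ S, ω ∈ openConn x z).card ≤ j} ∩
          {ω | (Finset.univ.filter fun u => u ∉ S ∧ ∃ v ∈ S, s(u, v) ∈ ω) = Y}) ≤
      (prodBernoulli w).real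
          {ω : BondConfig (Fin n) | (Finset.univ.filter fun u => u ∉ S ∧ ∃ v ∈ S, s(u, v) ∈ ω) = Y} *
        (prodBernoulli w).real {ω : BondConfig (Fin n) |
          (A.filter fun z => (openGraph (ω ∩ {e | ∀ v ∈ S, v ∉ e})).Reachable u z).card ≤ j} := by
  rw [← measureReal_gateEq_inter_off w S Y (fun ξ => (A.filter fun z => (openGraph ξ).Reachable u z).card ≤ j)]
  apply measureReal_mono _ (measure_ne_top _ _)
  rintro ω ⟨⟨-, hle⟩, hΓ⟩
  refine ⟨hΓ, ?_⟩
  simp only [Set.mem_setOf_eq]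
  have huΓ : u ∈ (Finset.univ.filter fun u => u ∉ S ∧ ∃ v ∈ S, s(u, v) ∈ ω) := by rw [hΓ]; exact hu
  obtain ⟨-, huS, v, hvS, huv⟩ := Finset.mem_filter.1 huΓ
  refine le_trans (Finset.card_le_card ?_) hle
  intro z hz
  rw [Finset.mem_filter] at hz ⊢
  refine ⟨hz.1, v, hvS, ?_⟩
  exact (reachable_of_gate huS hvS huv).trans (reachable_mono inter_subset_left hz.2)

/-- **Set-champion stability from the union bound over the first open port.**  `S` disjoint from `A`, `c ∈ A`, `c ∉ S`; `𝒴` carries the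
gate set a.s.; `g Y ∈ Y` for nonempty `Y ∈ 𝒴`.  If `Σ_{Y ∈ 𝒴, Y ≠ ∅} μ{Γ = Y}·μ{|π'(g Y)| ≤ j} ≤ μ(c ↮ S, |π(c)| ≤ j) + μ(c ↔ S, |π(S)| ≤ j)`
then `μ(c ↮ S, 1 ≤ |π(S)| ≤ j) ≤ μ(c ↮ S, |π(c)| ≤ j)`. [this file] -/
theorem setCS_of_unionBound (w : Sym2 (Fin n) → unitInterval) (A S : Finset (Fin n)) (c : Fin n) (j : ℕ)
    (hSA : Disjoint S A) (hcA : c ∈ A)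
    (𝒴 : Finset (Finset (Fin n)))
    (h𝒴 : (prodBernoulli w).real
      {ω : BondConfig (Fin n) | (Finset.univ.filter fun u => u ∉ S ∧ ∃ v ∈ S, s(u, v) ∈ ω) ∉ 𝒴} = 0)
    (g : Finset (Fin n) → Fin n) (hg : ∀ Y ∈ 𝒴, Y.Nonempty → g Y ∈ Y)
    (hUB : ∑ Y ∈ 𝒴.filter (fun Y => Y.Nonempty),
        (prodBernoulli w).real
            {ω : BondConfig (Fin n) | (Finset.univ.filter fun u => u ∉ S ∧ ∃ v ∈ S, s(u, v) ∈ ω) = Y} *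
          (prodBernoulli w).real {ω : BondConfig (Fin n) |
            (A.filter fun z => (openGraph (ω ∩ {e | ∀ v ∈ S, v ∉ e})).Reachable (g Y) z).card ≤ j} ≤
      (prodBernoulli w).real {ω : BondConfig (Fin n) | (∀ x ∈ S, ω ∉ openConn c x) ∧
          (A.filter fun z => ω ∈ openConn c z).card ≤ j} +
        (prodBernoulli w).real {ω : BondConfig (Fin n) | (∃ x ∈ S, ω ∈ openConn c x) ∧
          (A.filter fun z => ∃ x ∈ S, ω ∈ openConn x z).card ≤ j}) :
    (prodBernoulli w).real {ω : BondConfig (Fin n) | (∀ x ∈ S, ω ∉ openConn c x) ∧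
        1 ≤ (A.filter fun z => ∃ x ∈ S, ω ∈ openConn x z).card ∧
        (A.filter fun z => ∃ x ∈ S, ω ∈ openConn x z).card ≤ j} ≤
      (prodBernoulli w).real {ω : BondConfig (Fin n) | (∀ x ∈ S, ω ∉ openConn c x) ∧
        (A.filter fun z => ω ∈ openConn c z).card ≤ j} := by
  rw [bad_le_glued_iff_setCS w A S c j hcA]
  -- partition of the bad event by the gate class
  have hsum := measureReal_eq_sum_gateEq w S 𝒴 h𝒴 {ω : BondConfig (Fin n) |
    1 ≤ (A.filter fun z => ∃ x ∈ S, ω ∈ openConn x z).card ∧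
    (A.filter fun z => ∃ x ∈ S, ω ∈ openConn x z).card ≤ j}
  refine le_trans (le_of_eq hsum) (le_trans ?_ hUB)
  rw [Finset.sum_filter]
  refine Finset.sum_le_sum fun Y hY => ?_
  split_ifs with hne
  · exact bad_inter_gateEq_le w A S Y j (g Y) (hg Y hY hne)
  · -- `Y = ∅`: no gate, so `π(S) = ∅` and the bad event is empty on `{Γ = ∅}`
    have hY0 : Y = ∅ := Finset.not_nonempty_iff_eq_empty.1 hne
    have hempty : ({ω : BondConfig (Fin n) |
          1 ≤ (A.filter fun z => ∃ x ∈ S, ω ∈ openConn x z).card ∧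
          (A.filter fun z => ∃ x ∈ S, ω ∈ openConn x z).card ≤ j} ∩
        {ω | (Finset.univ.filter fun u => u ∉ S ∧ ∃ v ∈ S, s(u, v) ∈ ω) = Y}) = ∅ := by
      refine Set.eq_empty_iff_forall_notMem.2 ?_
      rintro ω ⟨⟨h1, -⟩, hΓY⟩
      have hfilt : (A.filter fun z => ∃ x ∈ S, ω ∈ openConn x z) = ∅ := by
        refine Finset.filter_eq_empty_iff.2 ?_
        intro z hz hex
        have hzS : z ∉ S := fun h => Finset.disjoint_left.1 hSA h hz
        obtain ⟨u, hu, -⟩ := (exists_reach_iff_gate hzS).1 hex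
        have hΓY' : (Finset.univ.filter fun u => u ∉ S ∧ ∃ v ∈ S, s(u, v) ∈ ω) = Y := hΓY
        rw [hΓY', hY0] at hu
        exact Finset.notMem_empty u hu
      rw [hfilt, Finset.card_empty] at h1
      exact Nat.not_succ_le_zero 0 h1
    rw [hempty, measureReal_empty]

end PortElimination

end Summit.CriticalPhenomena.PercolationContinuityZ3.Theorems

end
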